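import Summits.AtomisticToContinuum.Crystallization.Theorems.FrustratedLawDichotomyRuleToolkitGood
import Summits.AtomisticToContinuum.Crystallization.Theorems.FrustratedLawDichotomyAveragingCutC

/-!
# FrustratedLawDichotomy · the BALL-AVERAGING RULE: lens-5's door `D_AVG` IS a rule of the motif door (critic row 518 (6)(a), in Lean)

Critic row 518 (6)(a) (2026-08-31T17:06Z) asks whether lens-5 g35's ball-averaged pricing `LAP_ρ = BallAveragedPricing ρ …`
(`…AveragingCut`, p829084: «site `j` splits its surplus `x_j` equally among the sites of ITS OWN `ρ`-ball», kernel `LAP_ρ ⟹ T′♭`) is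
LITERALLY a transfer rule of hand-2 g12's discharging / motif door (`…LocalDischargingRule`, `…PairPotentialDoor`: `TransferRule`,
`HasRange`, `IsLocal`, `IsBounded`, `PairRuleCertificate`, `PairRuleMotifCertificate`), so that the two doors beneath the residual of
record `T′♭₄₅` become ONE object and adversaries / certificates feed both at once.  This file answers with theorems:

* §1 `avgRule ρ x` — the averaging rule of an arbitrary site feature `x` («`s` sends `x_s/#B(s,ρ)` to every site of `B(s,ρ)`») and the EXACT
  identity `x_i + netInflow (avgRule ρ x) i = ballAvg ρ y x i` (`netInflow_avgRule`; the outflow of `i` is exactly `x_i`, the inflow is the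
  ball average).  `HasRange ρ` always (`avgRule_hasRange`); `IsLocal ρ₁` as soon as the feature is `ρ₁`-local and `ρ ≤ ρ₁`
  (`avgRule_isLocal`); `IsBounded B` as soon as `|x| ≤ B` (`avgRule_isBounded`; the clipped twin `clipFeature B x` is always bounded and
  agrees with `x` wherever `|x| ≤ B` — bounding is idle for soundness in every kernel of the column, it only constrains the search).
* §2 ★ YES, LITERALLY: `BallAveragedPricing ρ η₀ η₁ W (eUp + A) κ_T C_T` ⟺ the sitewise inequality of
  `PairRuleCertificate η₀ η₁ W A (eUp + κ_T) (−C_T) (−κ_T) ρ ρ₁ B (avgRule ρ (surplusF …))` at every site of every injective `7/10`-separated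
  cluster (`ballAveragedPricing_iff_avgRule`; with the three restrictions granted, `pairRuleCertificate_avgRule_iff`).
* §3 THE HONEST CAVEAT AND ITS REPAIR.  lens-5's surplus carries the UNCAPPED flags `GoodAt η`; `GoodAt` is SCALE-FREE (a site whose nearest
  neighbour sits at distance `d` reads atoms out to `13/10·d`, `d` unbounded), so the uncapped averaging rule is NOT `IsLocal` at any fixed
  radius (a perfect kissing dozen at scale `d > ρ₁` around an otherwise isolated atom is good, its `ρ₁`-sub-cluster `{centre}` is not).  The
  repair is hand-2 g12's capped flag `goodFlag η D = 𝟙[GoodAtScale η D]` (`…RuleToolkitGood`, local for `η ≤ 3/10`, radius `13/10·D + 1`):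
  the CAPPED SURPLUS `surplusCap η₀ η₁ D W e κ_T C_T` is a `ρ₁`-local feature for `ρ₁ ≥ max (R_W, 13/10·D + 1)` (`surplusCap_isLocal`),
  `surplusCap ≤ surplus` (`κ_T, C_T ≥ 0`: a site good at a scale `> D` is simply charged as bad — the safe direction), hence
  `LAP^D_ρ := BallAveragedPricingCap ⟹ LAP_ρ ⟹ T′♭` (`ballAveragedPricing_of_cap`, `schurTopologicalPricing_of_ballAveragedCap`), and
  `avgRule ρ (surplusCap …)` HAS range `ρ` and locality `ρ₁` as THEOREMS (`avgRuleCap_restricted`).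
* §4 ★★ `LAP^D` IS MOTIF-LOCAL: for `ϱ ≥ ρ + ρ₁` the cluster statement (all injective Sep clusters, all sites) is EQUIVALENT to its restriction
  to the CENTRE of radius-`ϱ` MOTIFS (`ballAveragedPricingCap_iff_motif`), and the motif statement is LITERALLY
  `PairRuleMotifCertificate … (avgRule ρ (surplusCap …))` (`pairRuleMotifCertificate_avgRule_iff`).  So an `F2`-adversary of census
  TAG 181-S(iii)-AVG is a motif counterexample for this ONE rule of TAG 181 (c)'s search space, and a motif certificate for it closes `T′♭`
  through EITHER door.  Kernels: `schurTopologicalPricing_of_ballAveragedMotifCap` (any Schur cut whose `effPot` vanishes from `R` on) and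
  the crux BY NAME, generic and at the record node `(w₄₅, ω₄, 3/400)`: `aperiodicFrustratedLawGap_of_ballAveragedMotifCap`,
  ★ `aperiodicFrustratedLawGap_fourHalf_of_ballAveragedMotifCap` (+ the range-5 twin).

[folklore] bookkeeping (discharging); 0 sorry.  Prover hand 2, gen 13 (decomp-a2c), `--supports stmt-AtomisticToContinuum-27623`.
-/

noncomputable section

namespace Summit.AtomisticToContinuum.Crystallization.Theorems.FrustratedLawDichotomyAveragingRule

open scoped BigOperators Classical
open Literature.MathematicalPhysics.StatisticalMechanics (interactionEnergy siteEnergy)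
open Summit.AtomisticToContinuum.Crystallization.Theorems.ChargedEnergyGapNegative (E3)
open Summit.AtomisticToContinuum.Crystallization.Theorems.FrustratedLawDichotomyRangeCut
open Summit.AtomisticToContinuum.Crystallization.Theorems.FrustratedLawDichotomySchurCut
open Summit.AtomisticToContinuum.Crystallization.Theorems.FrustratedLawDichotomyLocalDischargingRule
open Summit.AtomisticToContinuum.Crystallization.Theorems.FrustratedLawDichotomyMotifLemmas
open Summit.AtomisticToContinuum.Crystallization.Theorems.FrustratedLawDichotomyPairPotentialDoor
open Summit.AtomisticToContinuum.Crystallization.Theorems.FrustratedLawDichotomyRuleToolkit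
open Summit.AtomisticToContinuum.Crystallization.Theorems.FrustratedLawDichotomyRuleToolkitGood
open Summit.AtomisticToContinuum.Crystallization.Theorems.FrustratedLawDichotomyAveragingCut
  (surplus ball ballAvg mem_ball card_ball_pos BallAveragedPricing schurTopologicalPricing_of_ballAveraged)

/-! ## §1. The averaging rule of a site feature: exact identity and the three restrictions -/

/-- **`avgRule ρ x` — the BALL-AVERAGING RULE of the site feature `x`**: site `s` sends `x_s / #B(s,ρ)` to every site of its own closed
`ρ`-ball `B(s,ρ)` (itself included — a self-transfer cancels in the net inflow). -/
def avgRule (ρ : ℝ) (x : SiteFeature) : TransferRule :=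
  fun N y s r => if r ∈ ball ρ y s then x N y s / ((ball ρ y s).card : ℝ) else 0

/-- `avgRule ρ x` has range `ρ`. [folklore] -/
theorem avgRule_hasRange (ρ : ℝ) (x : SiteFeature) : HasRange ρ (avgRule ρ x) := by
  intro N y s r hd
  unfold avgRule
  rw [if_neg]
  rw [mem_ball, dist_comm]
  exact not_le.mpr hd

/-- The INFLOW of `i` under `avgRule ρ x` is the ball average `Σ_{s ∈ B(i,ρ)} x_s/#B(s,ρ)`. [folklore] -/
theorem sum_avgRule_in (ρ : ℝ) (x : SiteFeature) (N : ℕ) (y : Fin N → E3) (i : Fin N) :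
    ∑ s, avgRule ρ x N y s i = ballAvg ρ y (x N y) i := by
  unfold avgRule ballAvg
  rw [← Finset.sum_filter]
  have hset : Finset.univ.filter (fun s : Fin N => i ∈ ball ρ y s) = ball ρ y i := by
    ext s
    simp [ball, dist_comm]
  rw [hset]

/-- The OUTFLOW of `i` under `avgRule ρ x` is exactly `x_i` (`ρ ≥ 0`, so `B(i,ρ) ∋ i` is nonempty). [folklore] -/
theorem sum_avgRule_out {ρ : ℝ} (hρ : 0 ≤ ρ) (x : SiteFeature) (N : ℕ) (y : Fin N → E3) (i : Fin N) :
    ∑ r, avgRule ρ x N y i r = x N y i := by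
  unfold avgRule
  rw [← Finset.sum_filter]
  have hset : Finset.univ.filter (fun r : Fin N => r ∈ ball ρ y i) = ball ρ y i := by
    ext r
    simp
  rw [hset, Finset.sum_const, nsmul_eq_mul]
  have hpos := card_ball_pos hρ y i
  field_simp

/-- ★ **THE EXACT IDENTITY**: `x_i + netInflow (avgRule ρ x) i = ballAvg ρ y x i` (`ρ ≥ 0`). [folklore] -/
theorem netInflow_avgRule {ρ : ℝ} (hρ : 0 ≤ ρ) (x : SiteFeature) (N : ℕ) (y : Fin N → E3) (i : Fin N) :
    x N y i + netInflow (avgRule ρ x) N y i = ballAvg ρ y (x N y) i := by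
  unfold netInflow
  rw [sum_avgRule_in, sum_avgRule_out hρ]
  ring

/-- ★ **Sitewise-after-`avgRule` ⟺ ball average `≥ 0`**, for any site term and any level. [folklore] -/
theorem le_add_netInflow_avgRule_iff {ρ : ℝ} (hρ : 0 ≤ ρ) (site level : SiteFeature) (N : ℕ) (y : Fin N → E3) (i : Fin N) :
    level N y i ≤ site N y i + netInflow (avgRule ρ (fun M z j => site M z j - level M z j)) N y i ↔
      0 ≤ ballAvg ρ y (fun j => site N y j - level N y j) i := by
  have h := netInflow_avgRule hρ (fun M z j => site M z j - level M z j) N y i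
  beta_reduce at h
  constructor
  · intro h1; linarith
  · intro h1; linarith

/-- `IsBounded`: `|x| ≤ B` everywhere ⟹ `IsBounded B (avgRule ρ x)` (`#B ≥ 1` on the support). [folklore] -/
theorem avgRule_isBounded {ρ B : ℝ} {x : SiteFeature} (hx : ∀ (N : ℕ) (y : Fin N → E3) (i : Fin N), |x N y i| ≤ B) :
    IsBounded B (avgRule ρ x) := by
  intro N y s r
  unfold avgRule
  split_ifs with h
  · have hc : (1 : ℝ) ≤ (ball ρ y s).card := by exact_mod_cast Finset.card_pos.mpr ⟨r, h⟩
    calc |x N y s / ((ball ρ y s).card : ℝ)| = |x N y s| / ((ball ρ y s).card : ℝ) := by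
          rw [abs_div, abs_of_pos (by linarith : (0 : ℝ) < (ball ρ y s).card)]
      _ ≤ |x N y s| := div_le_self (abs_nonneg _) hc
      _ ≤ B := hx N y s
  · simpa using (abs_nonneg _).trans (hx N y s)

/-- The closed `ρ`-ball of a site of a sub-cluster `y ∘ φ` containing every atom of `y` within `ρ` of it maps onto the ball in `y`. [folklore] -/
theorem map_ball_comp {ρ : ℝ} {N M : ℕ} {y : Fin N → E3} {φ : Fin M → Fin N} (hφ : Function.Injective φ) (a : Fin M)
    (hsub : ∀ k : Fin N, dist (y k) (y (φ a)) ≤ ρ → k ∈ Set.range φ) :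
    (ball ρ (y ∘ φ) a).map ⟨φ, hφ⟩ = ball ρ y (φ a) := by
  ext j
  simp only [Finset.mem_map, mem_ball, Function.Embedding.coeFn_mk, Function.comp_apply]
  constructor
  · rintro ⟨b, hb, rfl⟩
    exact hb
  · intro hj
    obtain ⟨b, rfl⟩ := hsub j hj
    exact ⟨b, hj, rfl⟩

/-- Hence the ball cardinalities agree. [folklore] -/
theorem card_ball_comp {ρ : ℝ} {N M : ℕ} {y : Fin N → E3} {φ : Fin M → Fin N} (hφ : Function.Injective φ) (a : Fin M)
    (hsub : ∀ k : Fin N, dist (y k) (y (φ a)) ≤ ρ → k ∈ Set.range φ) :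
    (ball ρ (y ∘ φ) a).card = (ball ρ y (φ a)).card := by
  rw [← map_ball_comp hφ a hsub, Finset.card_map]

/-- ★ `IsLocal`: a `ρ₁`-local feature with `ρ ≤ ρ₁` gives a `ρ₁`-local averaging rule (the sender's value AND its ball count are read off
the sender's `ρ₁`-neighbourhood; membership of the receiver is the pair distance). [folklore] -/
theorem avgRule_isLocal {ρ ρ₁ : ℝ} {x : SiteFeature} (hx : IsLocalFeature ρ₁ x) (hρ : ρ ≤ ρ₁) : IsLocal ρ₁ (avgRule ρ x) := by
  intro N M y φ hφ a b hsub
  have hsuba : ∀ k : Fin N, dist (y k) (y (φ a)) ≤ ρ₁ → k ∈ Set.range φ := fun k hk => hsub k (Or.inl hk)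
  unfold avgRule
  have hmem : b ∈ ball ρ (y ∘ φ) a ↔ φ b ∈ ball ρ y (φ a) := by simp only [mem_ball, Function.comp_apply]
  have hxa : x M (y ∘ φ) a = x N y (φ a) := hx N M y φ hφ a hsuba
  have hcard : ((ball ρ (y ∘ φ) a).card : ℝ) = (ball ρ y (φ a)).card := by
    exact_mod_cast card_ball_comp hφ a (fun k hk => hsuba k (hk.trans hρ))
  by_cases h : φ b ∈ ball ρ y (φ a)
  · rw [if_pos (hmem.2 h), if_pos h, hxa, hcard]
  · rw [if_neg (fun h' => h (hmem.1 h')), if_neg h]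

/-- **Clipped feature** `clipFeature B x = max (−B) (min B x)`. -/
def clipFeature (B : ℝ) (x : SiteFeature) : SiteFeature := fun N y i => max (-B) (min B (x N y i))

/-- `|clipFeature B x| ≤ B` for `B ≥ 0`. [folklore] -/
theorem abs_clipFeature_le {B : ℝ} (hB : 0 ≤ B) (x : SiteFeature) (N : ℕ) (y : Fin N → E3) (i : Fin N) :
    |clipFeature B x N y i| ≤ B :=
  abs_le.mpr ⟨le_max_left _ _, max_le (by linarith) (min_le_left _ _)⟩

/-- The clip is inactive where `|x| ≤ B`. [folklore] -/
theorem clipFeature_eq {B : ℝ} {x : SiteFeature} {N : ℕ} {y : Fin N → E3} {i : Fin N} (h : |x N y i| ≤ B) :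
    clipFeature B x N y i = x N y i := by
  obtain ⟨h1, h2⟩ := abs_le.mp h
  unfold clipFeature
  rw [min_eq_right h2, max_eq_right h1]

/-- A clipped local feature is local. [folklore] -/
theorem clipFeature_isLocal {ρ B : ℝ} {x : SiteFeature} (hx : IsLocalFeature ρ x) : IsLocalFeature ρ (clipFeature B x) :=
  IsLocalFeature.comp hx fun t => max (-B) (min B t)

/-- **The clipped averaging rule is a certified member of the search space**: range `ρ`, locality `ρ₁`, bound `B`. [folklore] -/
theorem avgRule_clip_restricted {ρ ρ₁ B : ℝ} {x : SiteFeature} (hB : 0 ≤ B) (hx : IsLocalFeature ρ₁ x) (hρ : ρ ≤ ρ₁) :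
    HasRange ρ (avgRule ρ (clipFeature B x)) ∧ IsLocal ρ₁ (avgRule ρ (clipFeature B x)) ∧ IsBounded B (avgRule ρ (clipFeature B x)) :=
  ⟨avgRule_hasRange _ _, avgRule_isLocal (clipFeature_isLocal hx) hρ, avgRule_isBounded (abs_clipFeature_le hB x)⟩

/-! ## §2. lens-5's `LAP_ρ` is LITERALLY the sitewise certificate of `avgRule ρ surplus` -/

/-- lens-5's surplus `x_j = ½·siteEnergy − e − κ_T·𝟙[¬GoodAt η₁] + C_T·𝟙[GoodAt η₀]` as a site feature. -/
def surplusF (η₀ η₁ : ℝ) (W : ℝ → ℝ) (e κT CT : ℝ) : SiteFeature := fun _ y => surplus η₀ η₁ W e κT CT y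

/-- `siteEnergy W y i = Σ_j W(r_ij) − W 0` (the diagonal term removed). [folklore] -/
theorem siteEnergy_eq (W : ℝ → ℝ) {N : ℕ} (y : Fin N → E3) (i : Fin N) :
    siteEnergy W y i = ∑ j, W (dist (y i) (y j)) - W 0 := by
  rw [siteEnergy, Finset.sum_erase_eq_sub (Finset.mem_univ i), dist_self]

/-- The surplus at level `e = eUp + A` is «site term minus level» in the parametrisation of `PairRuleCertificate`
(`c₀ = eUp + κ_T`, `c₁ = −C_T`, `c₂ = −κ_T`, constant one-body term `A`). [folklore] -/
theorem surplus_eq (η₀ η₁ : ℝ) (W : ℝ → ℝ) (A eUp κT CT : ℝ) {N : ℕ} (y : Fin N → E3) (j : Fin N) :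
    surplus η₀ η₁ W (eUp + A) κT CT y j =
      ((∑ k, W (dist (y j) (y k)) - W 0) / 2 - A) -
        ((eUp + κT) + (-CT) * (if GoodAt η₀ y j then (1 : ℝ) else 0) + (-κT) * (if GoodAt η₁ y j then (1 : ℝ) else 0)) := by
  unfold surplus
  rw [siteEnergy_eq]
  ring

/-- At one site: the sitewise inequality of the certificate of `avgRule ρ surplus` ⟺ `0 ≤ S_i`. [folklore] -/
theorem surplus_cert_iff {ρ : ℝ} (hρ : 0 ≤ ρ) (η₀ η₁ : ℝ) (W : ℝ → ℝ) (A eUp κT CT : ℝ) (N : ℕ) (y : Fin N → E3) (i : Fin N) :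
    (eUp + κT) + (-CT) * (if GoodAt η₀ y i then (1 : ℝ) else 0) + (-κT) * (if GoodAt η₁ y i then (1 : ℝ) else 0) ≤
        (∑ j, W (dist (y i) (y j)) - W 0) / 2 - A + netInflow (avgRule ρ (surplusF η₀ η₁ W (eUp + A) κT CT)) N y i ↔
      0 ≤ ballAvg ρ y (surplus η₀ η₁ W (eUp + A) κT CT y) i := by
  have h : surplus η₀ η₁ W (eUp + A) κT CT y i + netInflow (avgRule ρ (surplusF η₀ η₁ W (eUp + A) κT CT)) N y i =
      ballAvg ρ y (surplus η₀ η₁ W (eUp + A) κT CT y) i :=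
    netInflow_avgRule hρ (surplusF η₀ η₁ W (eUp + A) κT CT) N y i
  have e := surplus_eq η₀ η₁ W A eUp κT CT y i
  constructor
  · intro h1; linarith
  · intro h1; linarith

/-- ★ **YES, LITERALLY**: `LAP_ρ = BallAveragedPricing ρ η₀ η₁ W (eUp + A) κ_T C_T` ⟺ at every site of every injective `7/10`-separated
cluster the sitewise inequality of `PairRuleCertificate η₀ η₁ W A (eUp + κ_T) (−C_T) (−κ_T) … (avgRule ρ surplus)` holds. [folklore] -/
theorem ballAveragedPricing_iff_avgRule {ρ : ℝ} (hρ : 0 ≤ ρ) (η₀ η₁ : ℝ) (W : ℝ → ℝ) (A eUp κT CT : ℝ) :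
    BallAveragedPricing ρ η₀ η₁ W (eUp + A) κT CT ↔
      ∀ (N : ℕ) (y : Fin N → E3), Function.Injective y → Sep y → ∀ i : Fin N,
        (eUp + κT) + (-CT) * (if GoodAt η₀ y i then (1 : ℝ) else 0) + (-κT) * (if GoodAt η₁ y i then (1 : ℝ) else 0) ≤
          (∑ j, W (dist (y i) (y j)) - W 0) / 2 - A + netInflow (avgRule ρ (surplusF η₀ η₁ W (eUp + A) κT CT)) N y i :=
  forall_congr' fun N => forall_congr' fun y => forall_congr' fun _ => forall_congr' fun _ => forall_congr' fun i =>
    (surplus_cert_iff hρ η₀ η₁ W A eUp κT CT N y i).symm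

/-- A rule certificate for `avgRule ρ surplus` (any granted restrictions) IS `LAP_ρ`. [folklore] -/
theorem ballAveragedPricing_of_pairRuleCertificate {ρ R' ρ₁ B : ℝ} (hρ : 0 ≤ ρ) {η₀ η₁ : ℝ} {W : ℝ → ℝ} {A eUp κT CT : ℝ}
    (h : PairRuleCertificate η₀ η₁ W A (eUp + κT) (-CT) (-κT) R' ρ₁ B (avgRule ρ (surplusF η₀ η₁ W (eUp + A) κT CT))) :
    BallAveragedPricing ρ η₀ η₁ W (eUp + A) κT CT :=
  (ballAveragedPricing_iff_avgRule hρ η₀ η₁ W A eUp κT CT).2 h.2.2.2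

/-- ★ With locality `ρ₁` and bound `B` granted, `PairRuleCertificate … ρ ρ₁ B (avgRule ρ surplus) ⟺ LAP_ρ` (range `ρ` is a theorem). [folklore] -/
theorem pairRuleCertificate_avgRule_iff {ρ ρ₁ B : ℝ} (hρ : 0 ≤ ρ) {η₀ η₁ : ℝ} {W : ℝ → ℝ} {A eUp κT CT : ℝ}
    (hloc : IsLocal ρ₁ (avgRule ρ (surplusF η₀ η₁ W (eUp + A) κT CT)))
    (hbd : IsBounded B (avgRule ρ (surplusF η₀ η₁ W (eUp + A) κT CT))) :
    PairRuleCertificate η₀ η₁ W A (eUp + κT) (-CT) (-κT) ρ ρ₁ B (avgRule ρ (surplusF η₀ η₁ W (eUp + A) κT CT)) ↔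
      BallAveragedPricing ρ η₀ η₁ W (eUp + A) κT CT := by
  rw [ballAveragedPricing_iff_avgRule hρ]
  exact ⟨fun h => h.2.2.2, fun h => ⟨avgRule_hasRange _ _, hloc, hbd, h⟩⟩

/-- Hence `LAP_ρ ⟹ T′♭` is ALSO an instance of the pair-functional kernel `sum_le_of_pairRuleCertificate` / lens-5's double count — the
two kernels prove the same inequality (recorded for the concordance; this is `schurTopologicalPricing_of_ballAveraged`). [folklore] -/
theorem schurTopologicalPricing_of_ballAveraged' {ρ η₀ η₁ A eUp κT CT : ℝ} {w ω : ℝ → ℝ} (hρ : 0 ≤ ρ)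
    (h : BallAveragedPricing ρ η₀ η₁ (effPot w ω A) (eUp + A) κT CT) : SchurTopologicalPricing η₀ η₁ w ω A eUp κT CT := by
  intro N y hy hsep
  have hs := sum_le_interactionEnergy_of_transfers (effPot w ω A) A y
    (avgRule ρ (surplusF η₀ η₁ (effPot w ω A) (eUp + A) κT CT) N y)
    (fun i => ((ballAveragedPricing_iff_avgRule hρ η₀ η₁ (effPot w ω A) A eUp κT CT).1 h) N y hy hsep i)
  simp only [Finset.sum_add_distrib, Finset.sum_const, Finset.card_univ, Fintype.card_fin, nsmul_eq_mul, ← Finset.mul_sum] at hs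
  rw [← FrustratedLawDichotomyLocalPricing.goodCount_eq_sum, ← FrustratedLawDichotomyLocalPricing.goodCount_eq_sum] at hs
  linarith

end Summit.AtomisticToContinuum.Crystallization.Theorems.FrustratedLawDichotomyAveragingRule

end
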